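import Mathlib
import Summits.Ventures.HodgeRepro2.T6A1Dict

/-!
# T6A1EigenSplit — the linear algebra of a field action with one-dimensional eigenspaces (host-free)

Tier-6 sub-goal A1, Layer III (owner t6-p1, gen 2; STATUS ll. 5218, 5283 (4)). The four factors `A_i` of a
corner product carry, on `H¹(A_i, ℂ)`, the action of the sextic CM field `K` with ONE-DIMENSIONAL
eigenspaces (the host datum `CMVariety.finrank_eig`) and the Hodge decomposition `H¹ = H^{1,0} ⊕ H^{0,1}`
with the CM type `Φ = {τ | the τ-eigenline is of type (1,0)}` (`CMVariety.type_spec`). This file proves,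
for an abstract action `act : M →+* End_ℂ(V)` of a number field `M`:
* `iSupIndep_eigSub` — the `τ`-eigenspaces `eigSub act τ` (`T6A1Dict`) of the distinct embeddings
  `τ : M →+* ℂ` are independent (through a primitive element `θ` of `M`, which separates the embeddings:
  `exists_separating`);
* `eigSub_le_of_isCompl` — THE (0,1)-HALF OF LEMMA A0.5 WITHOUT CONJUGATION: if `V = U ⊕ U'` with `U`, `U'`
  both `act`-stable and the `τ`-eigenspace is a line not contained in `U`, then it is contained in `U'`
  (a `τ`-eigenvector `v = a + b`, `a ∈ U`, `b ∈ U'`; the uniqueness of the decomposition makes `a` and `b`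
  `τ`-eigenvectors; `a ≠ 0` would put the whole line in `U`);
* `card_le_finrank_of_eigSub_le` — a subspace containing the eigenlines of a finite set `S` of embeddings
  has dimension `≥ #S`;
* `finrank_eq_of_eigSub_le` — the Hodge numbers of a factor: if `V = U ⊕ U'`, both `act`-stable, every
  eigenspace a line, `eigSub act τ ≤ U ↔ τ ∈ Φ` and `dim V = #(M →+* ℂ)`, then `dim U = #Φ` and
  `dim U' = #Φᶜ`.
No host carrier, no display: pure Mathlib linear algebra over the vocabulary of `T6A1Dict.eigSub`.
§8(d): uses an L-value-free non-vanishing device: NO.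
-/

namespace Summit.Ventures.HodgeRepro2.T6.A1EigenSplit

open A1Dict

section separating

variable (M : Type*) [Field M] [NumberField M]

/-- A primitive element of the number field `M` separates its complex embeddings. -/
theorem exists_separating : ∃ θ : M, Function.Injective fun τ : M →+* ℂ => τ θ := by
  let pb := Field.powerBasisOfFiniteOfSeparable ℚ M
  refine ⟨pb.gen, fun τ τ' h => ?_⟩
  have h' : τ.toRatAlgHom = τ'.toRatAlgHom := pb.algHom_ext h
  exact RingHom.ext fun y => DFunLike.congr_fun h' y

end separating

section eigen

variable {M : Type*} [Field M] [NumberField M]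
variable {V : Type*} [AddCommGroup V] [Module ℂ V]
variable (act : M →+* Module.End ℂ V)

omit [NumberField M] in
/-- The joint eigenspace `eigSub act τ` lies in the `τ θ`-eigenspace of `act θ`. -/
theorem eigSub_le_eigenspace (θ : M) (τ : M →+* ℂ) :
    eigSub act τ ≤ Module.End.eigenspace (act θ) (τ θ) :=
  iInf_le (fun x : M => Module.End.eigenspace (act x) (τ x)) θ

/-- THE EIGENSPACES OF THE DISTINCT EMBEDDINGS ARE INDEPENDENT. -/
theorem iSupIndep_eigSub : iSupIndep fun τ : M →+* ℂ => eigSub act τ := by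
  obtain ⟨θ, hθ⟩ := exists_separating M
  exact ((Module.End.eigenspaces_iSupIndep (act θ)).comp hθ).mono fun τ =>
    eigSub_le_eigenspace act θ τ

omit [NumberField M] in
/-- An eigenspace of dimension one is not `⊥`. -/
theorem eigSub_ne_bot {τ : M →+* ℂ} (hline : Module.finrank ℂ (eigSub act τ) = 1) :
    eigSub act τ ≠ ⊥ := by
  intro h
  rw [h, finrank_bot] at hline
  exact zero_ne_one hline

omit [NumberField M] in
/-- THE (0,1)-HALF OF LEMMA A0.5, WITHOUT CONJUGATION: for `V = U ⊕ U'` with `U` and `U'` stable under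
the action and a one-dimensional `τ`-eigenspace NOT contained in `U`, the eigenspace is contained in
`U'`. -/
theorem eigSub_le_of_isCompl {U U' : Submodule ℂ V} (hc : IsCompl U U')
    (hU : ∀ x : M, ∀ v ∈ U, act x v ∈ U) (hU' : ∀ x : M, ∀ v ∈ U', act x v ∈ U') {τ : M →+* ℂ}
    (hline : Module.finrank ℂ (eigSub act τ) = 1) (hnot : ¬ eigSub act τ ≤ U) :
    eigSub act τ ≤ U' := by
  intro v hv
  have hv' : v ∈ U ⊔ U' := by rw [hc.sup_eq_top]; exact Submodule.mem_top
  obtain ⟨a, ha, b, hb, rfl⟩ := Submodule.mem_sup.1 hv'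
  -- `a` is a `τ`-eigenvector: `act x a - τ x • a ∈ U ⊓ U' = ⊥`
  have ha' : a ∈ eigSub act τ := by
    rw [mem_eigSub] at hv ⊢
    intro x
    have h1 := hv x
    rw [map_add, smul_add] at h1
    have hmem : act x a - τ x • a ∈ U ⊓ U' := by
      refine Submodule.mem_inf.2 ⟨U.sub_mem (hU x a ha) (U.smul_mem _ ha), ?_⟩
      have h2 : act x a - τ x • a = τ x • b - act x b := by
        rw [sub_eq_sub_iff_add_eq_add, h1, add_comm]
      rw [h2]
      exact U'.sub_mem (U'.smul_mem _ hb) (hU' x b hb)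
    rw [hc.inf_eq_bot, Submodule.mem_bot] at hmem
    exact sub_eq_zero.1 hmem
  by_cases ha0 : a = 0
  · subst ha0
    simpa using hb
  · exfalso
    apply hnot
    haveI : FiniteDimensional ℂ (eigSub act τ) :=
      Module.finite_of_finrank_pos (by rw [hline]; exact Nat.one_pos)
    have hspan : Submodule.span ℂ {a} = eigSub act τ := by
      refine Submodule.eq_of_le_of_finrank_eq (Submodule.span_le.2 (Set.singleton_subset_iff.2 ha')) ?_
      rw [finrank_span_singleton ha0, hline]
    rw [← hspan]
    exact Submodule.span_le.2 (Set.singleton_subset_iff.2 ha)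

/-- A subspace containing the (non-zero) eigenspaces of the embeddings in a finite set `S` has dimension
at least `#S`. -/
theorem card_le_finrank_of_eigSub_le [FiniteDimensional ℂ V] {U : Submodule ℂ V}
    (S : Finset (M →+* ℂ)) (hS : ∀ τ ∈ S, eigSub act τ ≤ U) (hne : ∀ τ ∈ S, eigSub act τ ≠ ⊥) :
    S.card ≤ Module.finrank ℂ U := by
  classical
  -- one non-zero vector in each eigenspace
  have hex : ∀ τ : S, ∃ v ∈ eigSub act (τ : M →+* ℂ), v ≠ 0 := fun τ =>
    (Submodule.ne_bot_iff _).1 (hne τ τ.2)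
  choose v hv hv0 using hex
  have hli : LinearIndependent ℂ v :=
    ((iSupIndep_eigSub act).comp Subtype.val_injective).linearIndependent _ hv hv0
  have hle : Submodule.span ℂ (Set.range v) ≤ U := by
    rw [Submodule.span_le]
    rintro _ ⟨τ, rfl⟩
    exact hS τ τ.2 (hv τ)
  have h1 := Submodule.finrank_mono hle
  rw [finrank_span_eq_card hli, Fintype.card_coe] at h1
  exact h1

/-- THE HODGE NUMBERS OF A FACTOR: if `V = U ⊕ U'` with both summands `act`-stable, every eigenspace a
line, `eigSub act τ ≤ U ↔ τ ∈ Φ`, and `dim V = #(M →+* ℂ)` (one line per embedding), then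
`dim U = #Φ` and `dim U' = #Φᶜ`. -/
theorem finrank_eq_of_eigSub_le [FiniteDimensional ℂ V] {U U' : Submodule ℂ V} (hc : IsCompl U U')
    (hU : ∀ x : M, ∀ v ∈ U, act x v ∈ U) (hU' : ∀ x : M, ∀ v ∈ U', act x v ∈ U')
    (hline : ∀ τ : M →+* ℂ, Module.finrank ℂ (eigSub act τ) = 1) (Φ : Set (M →+* ℂ))
    (hΦ : ∀ τ : M →+* ℂ, eigSub act τ ≤ U ↔ τ ∈ Φ)
    (hV : Module.finrank ℂ V = Fintype.card (M →+* ℂ)) :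
    Module.finrank ℂ U = Nat.card Φ ∧ Module.finrank ℂ U' = Nat.card (Φᶜ : Set (M →+* ℂ)) := by
  classical
  have hsum : Module.finrank ℂ U + Module.finrank ℂ U' = Fintype.card (M →+* ℂ) := by
    rw [← hV]; exact Submodule.finrank_add_eq_of_isCompl hc
  have hcard : Nat.card Φ + Nat.card (Φᶜ : Set (M →+* ℂ)) = Fintype.card (M →+* ℂ) := by
    rw [Nat.card_eq_fintype_card, Nat.card_eq_fintype_card, Fintype.card_compl_set]
    exact Nat.add_sub_cancel' (Fintype.card_le_of_injective _ Subtype.val_injective)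
  -- lower bounds
  have hU1 : Nat.card Φ ≤ Module.finrank ℂ U := by
    have := card_le_finrank_of_eigSub_le act (U := U) Φ.toFinset
      (fun τ hτ => (hΦ τ).2 (Set.mem_toFinset.1 hτ)) (fun τ _ => eigSub_ne_bot act (hline τ))
    rwa [Set.toFinset_card, ← Nat.card_eq_fintype_card] at this
  have hU2 : Nat.card (Φᶜ : Set (M →+* ℂ)) ≤ Module.finrank ℂ U' := by
    have := card_le_finrank_of_eigSub_le act (U := U') (Φᶜ : Set (M →+* ℂ)).toFinset
      (fun τ hτ => eigSub_le_of_isCompl act hc hU hU' (hline τ)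
        (fun h => Set.mem_toFinset.1 hτ ((hΦ τ).1 h)))
      (fun τ _ => eigSub_ne_bot act (hline τ))
    rwa [Set.toFinset_card, ← Nat.card_eq_fintype_card] at this
  constructor <;> omega

end eigen

end Summit.Ventures.HodgeRepro2.T6.A1EigenSplit
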